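import Summits.QuantumFields.YangMills.Theorems.FluctuationComparisonRegPrIntLS2BetaTubularChartDockFactorised
import Summits.QuantumFields.YangMills.Theorems.FluctuationComparisonRegPrIntLS2BetaLaplaceInstShift
import HarnessLib

/-!
# S2β · LAPLACE row — (CT-dock): THE COMMON-TUBE CORNER READING DOCKED ON THE FACTORISED CHART OF RECORD (pen w5-20520 g14)

Cell `ym3-torus` (rung R3: continuum `SU(2)` Yang–Mills on `T³` — NOT `d = 4`, NOT infinite volume, NOT a mass gap, NOT Clay); width seat `ym-ust-20520-w5` g14;
helper of the crux `stmt-QuantumFields-20520` (`--supports`, NOT a proof of it).  THEOREMS ONLY (0 `def`, 0 `sorry`; default heartbeats).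

WHY (DET-REP `stub_detRepLocalised` of LINE g18-1 `Lines/semiclassical_s2beta.lean` v10 @4cd723eb — the one displayed LAPLACE residue; common-tube route `N := 1`,
`M := Ah_{x(s,t)}`).  px21 g11 exported the product structure of the tubular Haar chart ((F1) window `UZ ×ˢ UV`, (F2) density `jZ ⊗ jV`, (F3) openness on the window:
✓`…TubularChartDockFactorised.exists_tubularHaarChart_pivotAct_factorised`, p745754), and ✓(CT) `…LaplaceInstShift.laplaceLimit_of_charts_tendsto_shift` (p745296) reads
LIMIT-INST at a shifted base point of such a tube.  THIS FILE composes the two BY NAME: ONE tube per base field `U₀` (the corner `U`'s minimiser), and for EVERY point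
`y₁ ∈ UV` of the transversal window (the coordinates `y(x')` of the other corners' minimiser orbits) the corner constant
`ℓ_{x'} = C · jV(y₁) · jac(x', σ y₁) ∕ √det Ah_{x'}` with `C = (2π)^{dV/2} ν(univ) (∫_{ball ρ} jZ) ∕ ν((e''ball ρ)·Sst) ∕ β_K^{dV/2}` CORNER-INDEPENDENT.

HONEST SCOPE.  A door (one `obtain`, one call); proves no stub; EXW ∕ GAP♯ ∕ DET-REP ∕ H4ᶜ ∕ LFR♯ᶜ ∕ LAPLACE ∕ S2β ∕ the crux 20520 NOT proved; `YM3TorusSU2` NOT proved;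
the Yang–Mills mass gap (Clay) NOT proved.

References: [Breitung1994] Thm 41 p. 56; [Balaban1985Variational] CMP 102 (1985) Thm 1 (8)–(10) p. 279; [Helgason2000] Ch. I §1 Thm 1.14 p. 96.
-/

noncomputable section

open MeasureTheory MeasureTheory.Measure Filter Topology Set Function Metric
open scoped ENNReal Matrix.Norms.L2Operator Real InnerProductSpace NNReal Pointwise
open Literature.MathematicalPhysics.QuantumFieldTheory.Balaban1983to89
open Literature.MathematicalPhysics.QuantumFieldTheory.Balaban1983to89.T3ContinuumYM3Torus
open Literature.MathematicalPhysics.QuantumFieldTheory.Balaban1983to89.T3UnitLawDensityEML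
open scoped Literature.MathematicalPhysics.QuantumFieldTheory.Balaban1983to89.T3OrbitAverage
open Summit.QuantumFields.YangMills.Theorems.FluctuationComparisonRegPrIntLWregChain (iterCentralBond iterCentralBond_injective)
open Summit.QuantumFields.YangMills.Theorems.FluctuationComparisonRegPrIntLWregGlue
open Summit.QuantumFields.YangMills.Theorems.FluctuationComparisonRegPrIntLS2BetaResidualSubgroup
open Summit.QuantumFields.YangMills.Theorems.FluctuationComparisonRegPrIntLS2BetaTubularChartDockFactorised
open Summit.QuantumFields.YangMills.Theorems.FluctuationComparisonRegPrIntLS2BetaLaplaceInstShift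

namespace Summit.QuantumFields.YangMills.Theorems.FluctuationComparisonRegPrIntLS2BetaLaplaceInstShiftDock

/-- ★★★ **(CT-dock) THE COMMON-TUBE CORNER READING, DOCKED ON px21's FACTORISED CHART OF RECORD.**  For `act := pivotAct F hJK (iterCentralBond (K−J))` on the residual
group of record, the nine CHART∞ rows at the datum `V`, and ANY base field `U₀`: px21's ✓`exists_tubularHaarChart_pivotAct_factorised` (p745754) supplies a product tube
⟨`e, σ, UZ, UV, jZ, jV, ρ`⟩ around the orbit of `U₀`, and FOR EVERY shifted base point `y₁ ∈ UV` carrying the point rows (local carrier row, stabiliser row, EXW's two rows,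
GAP♯'s strictness off the orbit of `σ y₁`, the Peano row of `y ↦ A(c.Φ(V, σ(y₁+y)))`) the scaled restricted partition function tends to
`(2π)^{dV/2}·ν(univ)·(((∫_{ball ρ} jZ)·jV y₁) ∕ ν((e '' ball ρ)·Sst))·jac(V, σ y₁) ∕ √det Ah ∕ β_K^{dV/2}` — ✓`laplaceLimit_of_charts_tendsto_shift` (p745296) with
`hopen₁ := Filter.le_map ((F3) at (0, y₁))`.  The exported rows `σ 0 = U₀`, `Continuous σ`, `ContDiff σ̂`, `IsOpen UV ∋ 0`, `Continuous jV`, `∀ᶠ y, 0 < jV y`,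
`0 < ∫_{ball ρ} jZ` are what the DET-REP (REP) hand needs to take logarithms and to run ✓(C2′)∕✓IFT-min along `y(x')`.
[cite: Breitung1994, Thm 41 p.56] [cite: Balaban1985Variational, Thm 1 (8)-(10) p.279] [cite: Helgason2000, Ch. I §1 Thm 1.14 p.96] -/
theorem cornerLimit_shift_of_dockFactorised
    (F : T3Family) {γ : ℝ} (hγ : 0 < γ) {J K : ℕ} (hJK : J ≤ K) (hk : K - J ≤ (F.P K).m + (F.P K).K)
    {Sf : Set (GaugeField (F.P K) 0 (Matrix.specialUnitaryGroup (Fin 2) ℂ))} (hSf : MeasurableSet Sf)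
    {O : Set (GaugeField (F.P J) 0 (Matrix.specialUnitaryGroup (Fin 2) ℂ))} (hO : IsOpen O)
    (c : WindowChart F hJK Sf O) {V : GaugeField (F.P J) 0 (Matrix.specialUnitaryGroup (Fin 2) ℂ)} (hV : V ∈ O) (m : ℝ)
    (ν : Measure (residualSubgroup F hJK × (PBond (F.P K) (K - J) → Matrix.specialUnitaryGroup (Fin 2) ℂ))) [ν.IsHaarMeasure]
    {Xc : Set (GaugeField (F.P K) 0 (Matrix.specialUnitaryGroup (Fin 2) ℂ))} (hXc : IsCompact Xc)
    (hXinv : ∀ k z, z ∈ Xc → pivotAct F hJK (iterCentralBond (P := F.P K) (K - J)) k z ∈ Xc)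
    (hvan : ∀ z, z ∉ Xc → (c.jac (V, z) : ℝ) = 0)
    (hA : ContinuousOn (fun z => wilsonAction4 (c.Φ (V, z))) Xc) (ha : ContinuousOn (fun z => (c.jac (V, z) : ℝ)) Xc)
    (hAinv : ∀ k, ∀ z ∈ Xc, wilsonAction4 (c.Φ (V, pivotAct F hJK (iterCentralBond (P := F.P K) (K - J)) k z)) = wilsonAction4 (c.Φ (V, z)))
    (hainv : ∀ k, ∀ z ∈ Xc, (c.jac (V, pivotAct F hJK (iterCentralBond (P := F.P K) (K - J)) k z) : ℝ) = c.jac (V, z))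
    (hOrel : IsOpen ((Subtype.val : Xc → GaugeField (F.P K) 0 (Matrix.specialUnitaryGroup (Fin 2) ℂ)) ⁻¹' {z | c.Φ (V, z) ∈ Sf}))
    (hOinv : ∀ k, ∀ z ∈ Xc, c.Φ (V, z) ∈ Sf → c.Φ (V, pivotAct F hJK (iterCentralBond (P := F.P K) (K - J)) k z) ∈ Sf)
    (dZ dV : ℕ)
    (hdZ : dZ = Module.finrank ℝ (specialUnitaryLogChart (Fin 2)).lie *
      ((Fintype.card (Site (F.P K) 0) - Fintype.card (Site (F.P K) (K - J))) + Fintype.card (PBond (F.P K) (K - J))))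
    (hdV : dV = Module.finrank ℝ (specialUnitaryLogChart (Fin 2)).lie *
        (Fintype.card (PBond (F.P K) 0) - Fintype.card (PBond (F.P K) (K - J))) -
      Module.finrank ℝ (specialUnitaryLogChart (Fin 2)).lie * (Fintype.card (Site (F.P K) 0) - Fintype.card (Site (F.P K) (K - J))))
    (U₀ : GaugeField (F.P K) 0 (Matrix.specialUnitaryGroup (Fin 2) ℂ)) :
    ∃ (e : EuclideanSpace ℝ (Fin dZ) → residualSubgroup F hJK × (PBond (F.P K) (K - J) → Matrix.specialUnitaryGroup (Fin 2) ℂ))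
      (σ : EuclideanSpace ℝ (Fin dV) → GaugeField (F.P K) 0 (Matrix.specialUnitaryGroup (Fin 2) ℂ))
      (UV : Set (EuclideanSpace ℝ (Fin dV)))
      (jZ : EuclideanSpace ℝ (Fin dZ) → ℝ) (jV : EuclideanSpace ℝ (Fin dV) → ℝ) (ρ : ℝ),
      σ 0 = U₀ ∧ Continuous σ ∧
      ContDiff ℝ ⊤ (fun y : EuclideanSpace ℝ (Fin dV) => fun b : PBond (F.P K) 0 =>
        ((σ y b : Matrix.specialUnitaryGroup (Fin 2) ℂ) : Matrix (Fin 2) (Fin 2) ℂ)) ∧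
      IsOpen UV ∧ (0 : EuclideanSpace ℝ (Fin dV)) ∈ UV ∧ Continuous jV ∧ (∀ᶠ y in 𝓝 (0 : EuclideanSpace ℝ (Fin dV)), 0 < jV y) ∧
      0 < ∫ z in ball (0 : EuclideanSpace ℝ (Fin dZ)) ρ, jZ z ∧
      ∀ {y₁ : EuclideanSpace ℝ (Fin dV)}, y₁ ∈ UV → (∀ᶠ y in 𝓝 y₁, σ y ∈ Xc) →
        ∀ {Sst : Set (residualSubgroup F hJK × (PBond (F.P K) (K - J) → Matrix.specialUnitaryGroup (Fin 2) ℂ))},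
          (∀ k, pivotAct F hJK (iterCentralBond (P := F.P K) (K - J)) k (σ y₁) = σ y₁ → k ∈ Sst) →
          (∀ s ∈ Sst, ∀ y, pivotAct F hJK (iterCentralBond (P := F.P K) (K - J)) s (σ y) = σ y) →
          c.Φ (V, σ y₁) ∈ Sf → wilsonAction4 (c.Φ (V, σ y₁)) = m →
          ∀ {g : GaugeField (F.P K) 0 (Matrix.specialUnitaryGroup (Fin 2) ℂ) → ℝ}, ContinuousOn g Xc → (∀ z ∈ Xc, 0 ≤ g z) →
            (∀ z ∈ Xc, (∀ k, pivotAct F hJK (iterCentralBond (P := F.P K) (K - J)) k (σ y₁) ≠ z) → 0 < g z) →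
            (∀ z ∈ Xc, c.Φ (V, z) ∈ Sf → m + g z ≤ wilsonAction4 (c.Φ (V, z))) →
            ∀ {Ah : EuclideanSpace ℝ (Fin dV) →ₗ[ℝ] EuclideanSpace ℝ (Fin dV)}, Ah.IsSymmetric → (∀ y, y ≠ 0 → 0 < ⟪Ah y, y⟫_ℝ) →
              ((fun y => wilsonAction4 (c.Φ (V, σ (y₁ + y))) - wilsonAction4 (c.Φ (V, σ y₁)) - (1 / 2) * ⟪Ah y, y⟫_ℝ) =o[𝓝 0] fun y => ‖y‖ ^ 2) →
              Tendsto (fun lam : ℝ => lam ^ ((dV : ℝ) / 2) *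
                  (heightDensityCan F (γ / lam) hJK Sf V * Real.exp (lam * (F.scheme ℰp γ).β K * m))) atTop
                (𝓝 (((2 * π) ^ ((dV : ℝ) / 2) * (ν.real univ *
                    (((∫ z in ball (0 : EuclideanSpace ℝ (Fin dZ)) ρ, jZ z) * jV y₁) /
                        (ν (((e '' ball (0 : EuclideanSpace ℝ (Fin dZ)) ρ) * Sst)⁻¹)).toReal * (c.jac (V, σ y₁) : ℝ) /
                      Real.sqrt (LinearMap.det Ah)))) / ((F.scheme ℰp γ).β K) ^ ((dV : ℝ) / 2))) := by
  obtain ⟨e, σ, UZ, UV, jZ, jV, ρ, he, he1, he𝓝, hσ, hσ0, hσs, -, -, -, -, hUZo, hUVo, h0Z, h0V, hinj, hF3,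
      hjZc, hjVc, hjZ0, hjV0, -, -, hjVev, hchart, hρ, hρUZ, hint⟩ :=
    exists_tubularHaarChart_pivotAct_factorised F hJK hk dZ dV hdZ hdV U₀
  refine ⟨e, σ, UV, jZ, jV, ρ, hσ0, hσ, hσs, hUVo, h0V, hjVc, hjVev, hint, ?_⟩
  intro y₁ hy₁ hσX₁ Sst hstab₁ hfix hO0 hmin g hg hg0 hgpos hgrow Ah hAs hpos hS2
  have hopen₁ : 𝓝 (σ y₁) ≤ map (fun p : EuclideanSpace ℝ (Fin dZ) × EuclideanSpace ℝ (Fin dV) =>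
      pivotAct F hJK (iterCentralBond (P := F.P K) (K - J)) (e p.1) (σ p.2)) (𝓝 (0, y₁)) := by
    have h1 : (fun p : EuclideanSpace ℝ (Fin dZ) × EuclideanSpace ℝ (Fin dV) =>
        pivotAct F hJK (iterCentralBond (P := F.P K) (K - J)) (e p.1) (σ p.2)) (0, y₁) = σ y₁ := by
      simp only [he1]; exact pivotAct_one F hJK _ _
    rw [← h1]
    exact Filter.le_map fun s hs => hF3 (0, y₁) ⟨h0Z, hy₁⟩ s hs
  exact laplaceLimit_of_charts_tendsto_shift F hγ hJK hSf hO c hV m (residualSubgroup F hJK) (compactSpace_residualSubgroup F hJK) ν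
    (pivotAct F hJK (iterCentralBond (P := F.P K) (K - J))) (continuous_pivotAct F hJK _)
    (pivotAct_mul F hJK _ (iterCentralBond_injective (P := F.P K) hk)) (pivotAct_one F hJK _) (measurePreserving_pivotAct F hJK _)
    hXc hXinv hvan hA ha hAinv hainv hOrel hOinv e σ he he1 he𝓝 hσ hUZo hUVo hinj hjZc.continuousOn hjVc.continuousOn
    (fun z _ => hjZ0 z) (fun y _ => hjV0 y) hchart hρ hρUZ hy₁ hopen₁ hσX₁ hstab₁ hfix hO0 hmin hg hg0 hgpos hgrow hAs hpos hS2


end Summit.QuantumFields.YangMills.Theorems.FluctuationComparisonRegPrIntLS2BetaLaplaceInstShiftDock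

end
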